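import Summits.ResolutionOfSingularities.ResolutionOfSingularities.Theorems.PurelyInseparableDim4AtlasCertThreeComputations
import Summits.ResolutionOfSingularities.ResolutionOfSingularities.Theorems.PurelyInseparableDim4AtlasCertCharts
import HarnessLib

/-!
# Purely inseparable four-folds: CHART FACTS for the first escaping certificate over a three-variable root centre (brick S3 (c) v4,
# tranche 1 instance A7-charts; cell `res-dim4-pi`)

[OURS · counted 0] (D-0157 DOOR 2; host item stmt-ResolutionOfSingularities-16155, helper). Nothing here proves resolution of
singularities in dimension ≥ 4 / characteristic `p`. For `F = x₂^p x₄ + x₁^{2p+1} + x₂^{3p+1} + x₃^{2p+1}` (A7, computations p-file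
`…AtlasCertThreeComputations`): the entry point of the root chart `x₁` is equimultiple; on chart `x₁` the normalised equimultiple pairs have `b₂ = 0`
(they lie on the child, the line `{x₂ = 0}` of the fibre `ℙ²`); the root chart `x₂` is dead (a lone `y₄`); the reading states of the child are
`F₀` / `F₂`; the four charts of the child's blow-up are dead (`F₀₀`: `∂₁ = 1 + y₃^{2p+1}` and the coefficient `(2p+1)·b₃^{2p}` of `y₁y₃`;
`F₀₁`, `F₂₁`: a lone `y₄`; `F₂₂`: `∂₃ = 1` on the owned normalised pairs). Pattern and helper lemmas = A6's `…AtlasCertCharts` (p719451).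

AI-produced formalisation, weaker than expert review. bears_on: LADDER-RESOLUTION:D157-DOOR2 (res-dim4-pi · S3 (c) v4 A7 charts).
-/

set_option linter.dupNamespace false -- D-0017: single-problem summit path `Summit.<S>.<S>.…` by design

noncomputable section

open MvPolynomial Finset

namespace Summit.ResolutionOfSingularities.ResolutionOfSingularities.Theorems.PIDim4

open Literature.AlgebraicGeometry.Resolution
open Literature.AlgebraicGeometry.Resolution.Hauser2010

namespace Equimultiple

section CCertCharts

variable {K : Type} [Field K] {p : ℕ} [hp : Fact p.Prime] [CharP K p]

/-! ## §1 The root's charts -/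

omit [CharP K p] in
/-- **The entry point is equimultiple**: at `b = 0` every monomial of `F₀` has degree `≥ p`. [cite: Hauser2010, §F (equiconstant points)] -/
theorem isEquimultiplePoint_C0_zero_ccert [DecidableEq K] (hp3 : 3 ≤ p) (s : State K)
    (hs : s.F = X 1 ^ p * X 3 + X 0 ^ (2 * p + 1) + X 1 ^ (3 * p + 1) + X 2 ^ (2 * p + 1)) :
    CentreBlowup.IsEquimultiplePoint p ({0, 1, 2} : Finset (Fin 4)) 0 (0 : Fin 4 → K) s := by
  intro d hd0 hdeg
  unfold CentreBlowup.pointTransform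
  rw [hs, chartTransform_C0_ccert, PointBlowup.translate_zero]
  by_contra hne
  rcases mem_support_four (mem_support_iff.mpr hne) with rfl | rfl | rfl | rfl <;>
    rw [Rescue.BedSlopeResidual.degree_E4] at hdeg <;> omega

omit [CharP K p] in
/-- **Chart `x₁`: the normalised equimultiple pairs lie on the child** (`b₁ = 0 ⇒ b₂ = 0`; the coefficient of `y₄` is `b₂^p`).
[cite: Hauser2010, §F (equiconstant points)] -/
theorem eq_zero_of_isEquimultiplePoint_C0_ccert [DecidableEq K] (hp3 : 3 ≤ p) {b : Fin 4 → K} (s : State K)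
    (hs : s.F = X 1 ^ p * X 3 + X 0 ^ (2 * p + 1) + X 1 ^ (3 * p + 1) + X 2 ^ (2 * p + 1))
    (h : CentreBlowup.IsEquimultiplePoint p ({0, 1, 2} : Finset (Fin 4)) 0 b s) (hb : b 0 = 0) : b 1 = 0 := by
  unfold CentreBlowup.IsEquimultiplePoint CentreBlowup.pointTransform at h
  rw [hs, chartTransform_C0_ccert] at h
  have hc := h (Finsupp.single 0 0 + Finsupp.single 1 0 + Finsupp.single 2 0 + Finsupp.single 3 1)
    (fun he => by have := DFunLike.congr_fun he 3; simp at this) (by rw [Rescue.BedSlopeResidual.degree_E4]; omega)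
  rw [Rescue.BedMohRiseQ4TopLocus.translate_add, Rescue.BedMohRiseQ4TopLocus.translate_add, Rescue.BedMohRiseQ4TopLocus.translate_add,
    coeff_add, coeff_add, coeff_add, coeff_translate_four, coeff_translate_four, coeff_translate_four, coeff_translate_four, hb,
    Nat.choose_eq_zero_of_lt (show 0 < 1 by omega)] at hc
  simp at hc
  exact hc.1

/-- **Root chart `x₂` is DEAD**: `∂₄ = 1`. [cite: Hauser2010, §F (equiconstant points)] -/
theorem not_isEquimultiplePoint_C1_ccert [DecidableEq K] {b : Fin 4 → K} (s : State K)
    (hs : s.F = X 1 ^ p * X 3 + X 0 ^ (2 * p + 1) + X 1 ^ (3 * p + 1) + X 2 ^ (2 * p + 1)) :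
    ¬ CentreBlowup.IsEquimultiplePoint p ({0, 1, 2} : Finset (Fin 4)) 1 b s := by
  have hpK : (p : K) = 0 := CharP.cast_eq_zero K p
  intro h
  unfold CentreBlowup.IsEquimultiplePoint CentreBlowup.pointTransform at h
  rw [hs, chartTransform_C1_ccert] at h
  have h3 := eval_pderiv_eq_zero_of_forall_coeff b _ h 3
  simp [(pderiv (3 : Fin 4)).leibniz_pow] at h3

omit [CharP K p] in
/-- **The main reading's state is `F₀`.** [cite: HauserPerlega2019PRIMS, §2 (cleaning)] -/
theorem step_C0_ccert [DecidableEq K] (s : State K)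
    (hs : s.F = X 1 ^ p * X 3 + X 0 ^ (2 * p + 1) + X 1 ^ (3 * p + 1) + X 2 ^ (2 * p + 1)) :
    (CentreBlowup.step p ({0, 1, 2} : Finset (Fin 4)) 0 (0 : Fin 4 → K) s).F =
      C 1 * (X 0 ^ 0 * X 1 ^ p * X 2 ^ 0 * X 3 ^ 1) +
        C 1 * (X 0 ^ (p + 1) * X 1 ^ 0 * X 2 ^ 0 * X 3 ^ 0) +
        C 1 * (X 0 ^ (2 * p + 1) * X 1 ^ (3 * p + 1) * X 2 ^ 0 * X 3 ^ 0) +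
        C 1 * (X 0 ^ (p + 1) * X 1 ^ 0 * X 2 ^ (2 * p + 1) * X 3 ^ 0) := by
  show deletePthPowers p (PointBlowup.translate (0 : Fin 4 → K)
    (CentreBlowup.chartTransform p ({0, 1, 2} : Finset (Fin 4)) 0 s.F)) = _
  rw [hs, chartTransform_C0_ccert, PointBlowup.translate_zero]
  exact Literature.Barriers.ResolutionOfSingularities.HauserPerlega.deletePthPowers_eq_self (isClean_F0_ccert hp.out.two_le)

omit [CharP K p] in
/-- **The extra reading's state is `F₂`.** [cite: HauserPerlega2019PRIMS, §2 (cleaning)] -/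
theorem escState_C2_ccert [DecidableEq K] (s : State K)
    (hs : s.F = X 1 ^ p * X 3 + X 0 ^ (2 * p + 1) + X 1 ^ (3 * p + 1) + X 2 ^ (2 * p + 1)) :
    (escState p ({0, 1, 2} : Finset (Fin 4)) 2 (0 : Fin 4 → K) s).F =
      C 1 * (X 0 ^ 0 * X 1 ^ p * X 2 ^ 0 * X 3 ^ 1) +
        C 1 * (X 0 ^ (2 * p + 1) * X 1 ^ 0 * X 2 ^ (p + 1) * X 3 ^ 0) +
        C 1 * (X 0 ^ 0 * X 1 ^ (3 * p + 1) * X 2 ^ (2 * p + 1) * X 3 ^ 0) +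
        C 1 * (X 0 ^ 0 * X 1 ^ 0 * X 2 ^ (p + 1) * X 3 ^ 0) := by
  show deletePthPowers p (PointBlowup.translate (0 : Fin 4 → K)
    (CentreBlowup.chartTransform p ({0, 1, 2} : Finset (Fin 4)) 2 s.F)) = _
  rw [hs, chartTransform_C2_ccert, PointBlowup.translate_zero]
  exact Literature.Barriers.ResolutionOfSingularities.HauserPerlega.deletePthPowers_eq_self (isClean_F2_ccert hp.out.two_le)

/-! ## §2 The child's charts are dead -/

/-- **Chart `{0,1}`/`y₁` of `F₀` is DEAD** (on the normalised pairs `b₁ = 0`): the coefficient of `y₁ y₃` is `(2p+1)·b₃^{2p}`, so `b₃ = 0`,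
and then `∂₁ = 1`. [cite: Hauser2010, §F (equiconstant points)] -/
theorem not_isEquimultiplePoint_U0_ccert [DecidableEq K] (hp3 : 3 ≤ p) {b : Fin 4 → K} (s : State K)
    (hs : s.F = C 1 * (X 0 ^ 0 * X 1 ^ p * X 2 ^ 0 * X 3 ^ 1) +
        C 1 * (X 0 ^ (p + 1) * X 1 ^ 0 * X 2 ^ 0 * X 3 ^ 0) +
        C 1 * (X 0 ^ (2 * p + 1) * X 1 ^ (3 * p + 1) * X 2 ^ 0 * X 3 ^ 0) +
        C 1 * (X 0 ^ (p + 1) * X 1 ^ 0 * X 2 ^ (2 * p + 1) * X 3 ^ 0))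
    (hb0 : b 0 = 0) :
    ¬ CentreBlowup.IsEquimultiplePoint p ({0, 1} : Finset (Fin 4)) 0 b s := by
  have hpK : (p : K) = 0 := CharP.cast_eq_zero K p
  intro h
  unfold CentreBlowup.IsEquimultiplePoint CentreBlowup.pointTransform at h
  rw [hs, chartTransform_U0_ccert] at h
  -- the coefficient of `y₁ y₃`
  have hc := h (Finsupp.single 0 1 + Finsupp.single 1 0 + Finsupp.single 2 1 + Finsupp.single 3 0)
    (fun he => by have := DFunLike.congr_fun he 0; simp at this) (by rw [Rescue.BedSlopeResidual.degree_E4]; omega)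
  rw [Rescue.BedMohRiseQ4TopLocus.translate_add, Rescue.BedMohRiseQ4TopLocus.translate_add, Rescue.BedMohRiseQ4TopLocus.translate_add,
    coeff_add, coeff_add, coeff_add, coeff_translate_four, coeff_translate_four, coeff_translate_four, coeff_translate_four, hb0,
    Nat.choose_eq_zero_of_lt (show 0 < 1 by omega)] at hc
  have h2p1 : ((2 * p + 1 : ℕ) : K) = 1 := by push_cast; rw [hpK]; ring
  simp [Nat.choose_one_right, h2p1] at hc
  -- then `∂₁ = 1`
  have h0 := eval_pderiv_eq_zero_of_forall_coeff b _ h 0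
  simp [(pderiv (0 : Fin 4)).leibniz_pow, hb0, hc] at h0

/-- **Chart `{0,1}`/`y₂` of `F₀` is DEAD**: `∂₄ = 1`. [cite: Hauser2010, §F (equiconstant points)] -/
theorem not_isEquimultiplePoint_U1_ccert [DecidableEq K] {b : Fin 4 → K} (s : State K)
    (hs : s.F = C 1 * (X 0 ^ 0 * X 1 ^ p * X 2 ^ 0 * X 3 ^ 1) +
        C 1 * (X 0 ^ (p + 1) * X 1 ^ 0 * X 2 ^ 0 * X 3 ^ 0) +
        C 1 * (X 0 ^ (2 * p + 1) * X 1 ^ (3 * p + 1) * X 2 ^ 0 * X 3 ^ 0) +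
        C 1 * (X 0 ^ (p + 1) * X 1 ^ 0 * X 2 ^ (2 * p + 1) * X 3 ^ 0)) :
    ¬ CentreBlowup.IsEquimultiplePoint p ({0, 1} : Finset (Fin 4)) 1 b s := by
  have hpK : (p : K) = 0 := CharP.cast_eq_zero K p
  intro h
  unfold CentreBlowup.IsEquimultiplePoint CentreBlowup.pointTransform at h
  rw [hs, chartTransform_U1_ccert] at h
  have h3 := eval_pderiv_eq_zero_of_forall_coeff b _ h 3
  simp [(pderiv (3 : Fin 4)).leibniz_pow] at h3

/-- **Chart `{1,2}`/`y₂` of `F₂` is DEAD**: `∂₄ = 1`. [cite: Hauser2010, §F (equiconstant points)] -/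
theorem not_isEquimultiplePoint_W1_ccert [DecidableEq K] {b : Fin 4 → K} (s : State K)
    (hs : s.F = C 1 * (X 0 ^ 0 * X 1 ^ p * X 2 ^ 0 * X 3 ^ 1) +
        C 1 * (X 0 ^ (2 * p + 1) * X 1 ^ 0 * X 2 ^ (p + 1) * X 3 ^ 0) +
        C 1 * (X 0 ^ 0 * X 1 ^ (3 * p + 1) * X 2 ^ (2 * p + 1) * X 3 ^ 0) +
        C 1 * (X 0 ^ 0 * X 1 ^ 0 * X 2 ^ (p + 1) * X 3 ^ 0)) :
    ¬ CentreBlowup.IsEquimultiplePoint p ({1, 2} : Finset (Fin 4)) 1 b s := by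
  have hpK : (p : K) = 0 := CharP.cast_eq_zero K p
  intro h
  unfold CentreBlowup.IsEquimultiplePoint CentreBlowup.pointTransform at h
  rw [hs, chartTransform_W1_ccert] at h
  have h3 := eval_pderiv_eq_zero_of_forall_coeff b _ h 3
  simp [(pderiv (3 : Fin 4)).leibniz_pow] at h3

/-- **Chart `{1,2}`/`y₃` of `F₂` is DEAD on the owned normalised pairs** (`b₁ = 0` owned, `b₃ = 0` exceptional): `∂₃ = 1`.
[cite: Hauser2010, §F (equiconstant points)] -/
theorem not_isEquimultiplePoint_W2_ccert [DecidableEq K] {b : Fin 4 → K} (s : State K)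
    (hs : s.F = C 1 * (X 0 ^ 0 * X 1 ^ p * X 2 ^ 0 * X 3 ^ 1) +
        C 1 * (X 0 ^ (2 * p + 1) * X 1 ^ 0 * X 2 ^ (p + 1) * X 3 ^ 0) +
        C 1 * (X 0 ^ 0 * X 1 ^ (3 * p + 1) * X 2 ^ (2 * p + 1) * X 3 ^ 0) +
        C 1 * (X 0 ^ 0 * X 1 ^ 0 * X 2 ^ (p + 1) * X 3 ^ 0))
    (hb0 : b 0 = 0) (hb2 : b 2 = 0) :
    ¬ CentreBlowup.IsEquimultiplePoint p ({1, 2} : Finset (Fin 4)) 2 b s := by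
  have hpK : (p : K) = 0 := CharP.cast_eq_zero K p
  intro h
  unfold CentreBlowup.IsEquimultiplePoint CentreBlowup.pointTransform at h
  rw [hs, chartTransform_W2_ccert] at h
  have h2 := eval_pderiv_eq_zero_of_forall_coeff b _ h 2
  simp [(pderiv (2 : Fin 4)).leibniz_pow, hb0, hb2] at h2

end CCertCharts

end Equimultiple

end Summit.ResolutionOfSingularities.ResolutionOfSingularities.Theorems.PIDim4

end
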